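import Literature.IUT.LogThetaLattice.PacketWeights
import Literature.Algebra.PolynomialIdentities.WeightedAverages
import HarnessLib

/-!
# [IUTchIV] Remark 1.7.1: the normalized weights when one works with NORMALIZED log-volumes

Mochizuki, *Inter-universal Teichmüller theory IV*, §1, Remark 1.7.1, kurims pp. 17–18, read on the
page: "the normalized weights discussed in [IUTchIII], Remark 3.1.1, (ii), were computed relative to the
non-normalized log-volumes of [AbsTopIII], Proposition 5.8, (iii), (vi) … By contrast, in the discussion
of the present §1, our computations are performed relative to normalized log-volumes as discussed in
Proposition 1.4, (i). In particular, it follows that the weights `[K_v : (F_mod)_v]^{-1}` … must be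
replaced — i.e., when one works with normalized log-volumes as in Proposition 1.4, (i) — by the weights
`[K_v : ℚ_{v_ℚ}]·[K_v : (F_mod)_v]^{-1} = [(F_mod)_v : ℚ_{v_ℚ}]` … This means that the normalized
weights of the final display of [IUTchIII], Remark 3.1.1, (ii), must be replaced … by the normalized
weights `(Π_{α∈A} [(F_mod)_{v_α} : ℚ_{v_ℚ}]) / Σ_{{w_α}_{α∈A}} (Π_{α∈A} [(F_mod)_{w_α} : ℚ_{v_ℚ}])`
… Thus, in summary, when one works with normalized log-volumes as in Proposition 1.4, (i), the
appropriate normalized weights are given by the expressions `λ_{Π e†} / Σ_{e ∈ E^n} λ_{Π e}` that appear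
in Proposition 1.7 … `λ_e := [(F_mod)_v : ℚ_{v_ℚ}]`."

This file TYPES the replaced weights (`normalizedTensorWeight degF vA`, with `degF w = [(F_mod)_w :
ℚ_{v_ℚ}]`) and PROVES the three assertions of the Remark as identities:
* `packetWeight_mul_localDegree` / `packetWeightTensor_mul_dim` — [IUTchIII] Rmk. 3.1.1 (ii)'s weight
  (L6's `packetWeight` / `packetWeightTensor`) times the `ℚ_{v_ℚ}`-dimension `[K_v : ℚ_{v_ℚ}] =
  [K_v:(F_mod)_v]·[(F_mod)_v:ℚ_{v_ℚ}]` (resp. `Π_α [K_{v_α} : ℚ_{v_ℚ}]`) — i.e. the passage from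
  non-normalized to normalized log-volumes ([IUTchIV] Prop. 1.4 (i): divide by the dimension) — IS
  the replaced weight;
* `normalizedTensorWeight_eq_tupleLam` — the replaced weight IS the expression `λ_{Πe†}/Σ λ_{Πe}` of
  Prop. 1.7 (tree: `Literature.Algebra.PolynomialIdentities.WeightedAverage.tupleLam`);
* `sum_normalizedTensorWeight` — the replaced weights sum to `1`.
[cite: Mochizuki2012, IUTchIV Rmk. 1.7.1 pp. 17–18] [cite: Mochizuki2012, IUTchIII Rmk. 3.1.1 (ii) p. 94]
Deliberately NOT here: the application in Theorem 1.10 (abc-iut-S3's files), any judgement on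
[IUTchIII] Cor. 3.12.
-/

noncomputable section

open Finset

namespace Literature.IUT.LogVolume

variable {W : Type*} [Fintype W]

/-! ### The replaced weights -/

omit [Fintype W] in
/-- The weight replacing `[K_v : (F_mod)_v]^{-1}` when log-volumes are normalized:
`[K_v : ℚ_{v_ℚ}]·[K_v : (F_mod)_v]^{-1} = [(F_mod)_v : ℚ_{v_ℚ}]` — here simply `degF v`, and the identity
is `localDegree_mul_inv_relDegree`. [cite: Mochizuki2012, IUTchIV Rmk. 1.7.1 p. 17] -/
theorem localDegree_mul_inv_relDegree (degF degKF : W → ℕ+) (w : W) :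
    ((degKF w : ℝ) * (degF w : ℝ)) * ((degKF w : ℝ))⁻¹ = (degF w : ℝ) := by
  have hk : (degKF w : ℝ) ≠ 0 := by exact_mod_cast (degKF w).pos.ne'
  field_simp

/-- The **normalized weight for normalized log-volumes** attached to a collection `{v_α}_{α∈A}` of places
over `v_ℚ` (final display of Rmk. 1.7.1): `(Π_α [(F_mod)_{v_α} : ℚ_{v_ℚ}]) / Σ_{{w_α}} Π_α [(F_mod)_{w_α} :
ℚ_{v_ℚ}]`. [cite: Mochizuki2012, IUTchIV Rmk. 1.7.1 p. 18] -/
def normalizedTensorWeight {A : Type*} [Fintype A] [DecidableEq A] (degF : W → ℕ+) (vA : A → W) : ℝ :=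
  (∏ a, (degF (vA a) : ℝ)) / ∑ wA : A → W, ∏ a, (degF (wA a) : ℝ)

omit [Fintype W] in
/-- Positive naturals cast to positive reals. [folklore] -/
private lemma pnat_cast_pos' (n : ℕ+) : (0 : ℝ) < (n : ℝ) := by exact_mod_cast n.pos

/-- The denominator `Σ_{{w_α}} Π_α [(F_mod)_{w_α} : ℚ_{v_ℚ}]` is positive (`W` nonempty).
[cite: Mochizuki2012, IUTchIV Rmk. 1.7.1 p. 18] -/
theorem sum_prod_degF_pos [Nonempty W] {A : Type*} [Fintype A] [DecidableEq A] (degF : W → ℕ+) :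
    (0 : ℝ) < ∑ wA : A → W, ∏ a, (degF (wA a) : ℝ) :=
  Finset.sum_pos (fun w _ => Finset.prod_pos fun a _ => pnat_cast_pos' (degF (w a))) univ_nonempty

/-- The replaced weights are nonnegative. [cite: Mochizuki2012, IUTchIV Rmk. 1.7.1 p. 18] -/
theorem normalizedTensorWeight_nonneg {A : Type*} [Fintype A] [DecidableEq A] (degF : W → ℕ+) (vA : A → W) :
    0 ≤ normalizedTensorWeight degF vA :=
  div_nonneg (Finset.prod_nonneg fun a _ => (pnat_cast_pos' (degF (vA a))).le)
    (Finset.sum_nonneg fun w _ => Finset.prod_nonneg fun a _ => (pnat_cast_pos' (degF (w a))).le)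

/-- **The replaced weights sum to `1`.** [cite: Mochizuki2012, IUTchIV Rmk. 1.7.1 p. 18] -/
theorem sum_normalizedTensorWeight [Nonempty W] {A : Type*} [Fintype A] [DecidableEq A] (degF : W → ℕ+) :
    ∑ vA : A → W, normalizedTensorWeight degF vA = 1 := by
  unfold normalizedTensorWeight
  rw [← Finset.sum_div, div_self (sum_prod_degF_pos degF).ne']

/-! ### Rmk. 3.1.1 (ii)'s weights times the dimension are the replaced weights -/

/-- **Single place.** [IUTchIII] Rmk. 3.1.1 (ii)'s normalized weight `1/([K_v:(F_mod)_v]·Σ_w [(F_mod)_w:ℚ])`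
(L6's `packetWeight`) times the `ℚ_{v_ℚ}`-dimension `[K_v : ℚ_{v_ℚ}] = [K_v:(F_mod)_v]·[(F_mod)_v:ℚ_{v_ℚ}]`
— the factor between non-normalized and normalized log-volumes ([IUTchIV] Prop. 1.4 (i)) — is the
replaced weight `[(F_mod)_v : ℚ_{v_ℚ}] / Σ_w [(F_mod)_w : ℚ_{v_ℚ}]`. [cite: Mochizuki2012, IUTchIV Rmk. 1.7.1 p. 17] -/
theorem packetWeight_mul_localDegree [Nonempty W] (degF degKF : W → ℕ+) (w : W) :
    LogThetaLattice.packetWeight degF degKF w * ((degKF w : ℝ) * (degF w : ℝ)) =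
      (degF w : ℝ) / ∑ w', (degF w' : ℝ) := by
  have hk : (degKF w : ℝ) ≠ 0 := by exact_mod_cast (degKF w).pos.ne'
  have hS : (∑ w', (degF w' : ℝ)) ≠ 0 :=
    (Finset.sum_pos (fun w _ => pnat_cast_pos' (degF w)) univ_nonempty).ne'
  unfold LogThetaLattice.packetWeight
  field_simp

/-- **Tensor packets.** [IUTchIII] Rmk. 3.1.1 (ii)'s normalized weight of the summand indexed by
`{v_α}_{α∈A}` (L6's `packetWeightTensor`) times the `ℚ_{v_ℚ}`-dimension `Π_α [K_{v_α} : ℚ_{v_ℚ}]` of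
`⊗_α K_{v_α}` is the replaced weight `normalizedTensorWeight`. [cite: Mochizuki2012, IUTchIV Rmk. 1.7.1 p. 18] -/
theorem packetWeightTensor_mul_dim [Nonempty W] {A : Type*} [Fintype A] [DecidableEq A]
    (degF degKF : W → ℕ+) (vA : A → W) :
    LogThetaLattice.packetWeightTensor degF degKF vA * ∏ a, ((degKF (vA a) : ℝ) * (degF (vA a) : ℝ)) =
      normalizedTensorWeight degF vA := by
  have hk : (∏ a, (degKF (vA a) : ℝ)) ≠ 0 :=
    (Finset.prod_pos fun a _ => pnat_cast_pos' (degKF (vA a))).ne'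
  have hS : (∑ wA : A → W, ∏ a, (degF (wA a) : ℝ)) ≠ 0 := (sum_prod_degF_pos degF).ne'
  unfold LogThetaLattice.packetWeightTensor normalizedTensorWeight
  rw [Finset.prod_mul_distrib]
  field_simp

/-- Consequently the normalisation property transports: if the NORMALIZED log-volume of every summand
changes by `c`, the `normalizedTensorWeight`-weighted sum changes by `c` (the replaced weights are
probability weights). [cite: Mochizuki2012, IUTchIV Rmk. 1.7.1 p. 18] -/
theorem sum_normalizedTensorWeight_mul_const [Nonempty W] {A : Type*} [Fintype A] [DecidableEq A] (degF : W → ℕ+)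
    (c : ℝ) : ∑ vA : A → W, normalizedTensorWeight degF vA * c = c := by
  rw [← Finset.sum_mul, sum_normalizedTensorWeight, one_mul]

/-! ### The replaced weights are the `λ_{Πe}/Σ λ_{Πe}` of Proposition 1.7 -/

/-- **Rmk. 1.7.1, last sentence**: with `E := W` (the places over `v_ℚ`), `n := #A` and
`λ_e := [(F_mod)_e : ℚ_{v_ℚ}]`, the replaced weight of an `n`-tuple `e†` is the expression
`λ_{Π e†} / Σ_{e ∈ E^n} λ_{Π e}` appearing in Proposition 1.7 (tree: `WeightedAverage.tupleLam`).
[cite: Mochizuki2012, IUTchIV Rmk. 1.7.1 p. 18] -/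
theorem normalizedTensorWeight_eq_tupleLam {n : ℕ} (degF : W → ℕ+) (e : Fin n → W) :
    normalizedTensorWeight degF e =
      Algebra.PolynomialIdentities.WeightedAverage.tupleLam (fun w => (degF w : ℝ)) e /
        ∑ e' : Fin n → W, Algebra.PolynomialIdentities.WeightedAverage.tupleLam (fun w => (degF w : ℝ)) e' := by
  simp only [normalizedTensorWeight, Algebra.PolynomialIdentities.WeightedAverage.tupleLam]

/-- With these weights, Proposition 1.7 computes the weighted average of the tuple sums `β_e = Σ_j β_{e_j}`
as `n·β_avg` (tree: `WeightedAverage.weightedAverage_eq`); restated for the replaced weights: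
`Σ_e normalizedTensorWeight(e)·β_e = (Σ_e β_e λ_{Πe}) / Σ_e λ_{Πe}`.
[cite: Mochizuki2012, IUTchIV Rmk. 1.7.1 p. 17] -/
theorem sum_normalizedTensorWeight_mul {n : ℕ} (degF : W → ℕ+) (β : (Fin n → W) → ℝ) :
    ∑ e : Fin n → W, normalizedTensorWeight degF e * β e =
      (∑ e : Fin n → W, β e * ∏ j, (degF (e j) : ℝ)) / ∑ e' : Fin n → W, ∏ j, (degF (e' j) : ℝ) := by
  unfold normalizedTensorWeight
  rw [Finset.sum_div]
  refine Finset.sum_congr rfl fun e _ => ?_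
  ring

end Literature.IUT.LogVolume
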